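import Summits.NavierStokesRegularity.NavierStokesRegularity.Theorems.TypeILiouvilleTypeIliouvilleNoTypeIIEternalEnergyLiouvilleLimitSet
import HarnessLib

/-!
# Extremal profiles of the EEL′ class: a nonzero member yields a member attaining its supremum
# modulus at the origin (crux `TypeIliouvilleNoTypeII`, stmt-NavierStokesRegularity-0056; rigidity
# residual EEL′ of the pressure-free eternal split)

Helper file (theorems only).  The sup-attained REDUCTION of EEL′ (`eternalLiouvillePressureFree_of_supAttained`,
p472579) is an implication between two open statements.  This file records its constructive content
as an EXISTENCE theorem over the EEL′ class (bounded eternal Oseen-mild smooth divergence-free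
fields with `A_ess, C, E ≤ I` on all parabolic balls), using the compactness of the class modulo
translations (`exists_limit_of_translates`, p482393):

* `exists_extremal_of_ne_zero` — if a member `v` with `‖v‖ ≤ N` is not identically zero, then there
  is a member `W` of the same class (same `N`, same `I`), obtained as a pointwise limit of
  space–time translates of `v`, with `‖W(s, y)‖ ≤ ‖W(0, 0)‖ = sup ‖v‖ > 0` for all `(s, y)` — an
  EXTREMAL profile.  So EEL′ is equivalent to the non-existence of extremal profiles, and every
  normal-form computation at a space–time maximum of `|W|²` (`∂ₛ|W|² = 0`, `∇|W|² = 0`, `Δ|W|² ≤ 0`)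
  applies to the open core without loss.

WHAT THIS IS NOT: not NS; EEL′ stays OPEN. [folklore]
-/

noncomputable section

-- the summit and its single problem share the name `NavierStokesRegularity` (D-0017 nested layout)
set_option linter.dupNamespace false

open Set Function Filter Topology MeasureTheory Metric
open scoped NNReal ENNReal

namespace Summit.NavierStokesRegularity.NavierStokesRegularity.Theorems.TypeIliouvilleNoTypeII.TypeIIZoom

open Literature.Analysis Literature.Analysis.FluidPDE

variable {v : ℝ → EuclideanSpace ℝ (Fin 3) → EuclideanSpace ℝ (Fin 3)}

/-- **Extremal profiles exist in the EEL′ class.**  Let `v` be a bounded eternal Oseen-mild smooth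
divergence-free field, `‖v‖ ≤ N`, with `A_ess, C, E ≤ I` on all parabolic balls, and suppose
`v(t₀, x₀) ≠ 0` for some `(t₀, x₀)`.  Then some sequence of space–time translates of `v` converges at
every point to a member `W` of the same class with `0 < ‖W(0,0)‖ = sup_{s,y} ‖v(s,y)‖` and
`‖W(s, y)‖ ≤ ‖W(0, 0)‖` everywhere. [cite: KochNadirashviliSereginSverak2009, Lemma 6.1 and Prop. 4.1 (arXiv:0709.3599 pp. 8, 11)] -/
theorem exists_extremal_of_ne_zero (hv : ContDiff ℝ (⊤ : ℕ∞) (uncurry v))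
    (hdiv : ∀ t, VectorCalculus.IsDivFree (v t))
    (hmild : ∀ s t : ℝ, s < t → ∀ x, v t x = heatFlow (v s) (t - s) x - oseenDuhamel 1 s v v t x)
    {N : ℝ} (hbd : ∀ (t : ℝ) (x : EuclideanSpace ℝ (Fin 3)), ‖v t x‖ ≤ N) {I : ℝ≥0∞}
    (hball : ∀ r : ℝ, 0 < r → ∀ z : ℝ × EuclideanSpace ℝ (Fin 3),
      cknAEss r z v ≤ I ∧ cknC r z v ≤ I ∧ cknE r z (fun s y => fderiv ℝ (v s) y) ≤ I)
    {t₀ : ℝ} {x₀ : EuclideanSpace ℝ (Fin 3)} (h0 : v t₀ x₀ ≠ 0) :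
    ∃ (c : ℕ → ℝ) (a : ℕ → EuclideanSpace ℝ (Fin 3))
      (W : ℝ → EuclideanSpace ℝ (Fin 3) → EuclideanSpace ℝ (Fin 3)),
      ContDiff ℝ (⊤ : ℕ∞) (uncurry W) ∧ (∀ t, VectorCalculus.IsDivFree (W t)) ∧
      (∀ s t : ℝ, s < t → ∀ x, W t x = heatFlow (W s) (t - s) x - oseenDuhamel 1 s W W t x) ∧
      (∀ t x, ‖W t x‖ ≤ N) ∧
      (∀ r : ℝ, 0 < r → ∀ z : ℝ × EuclideanSpace ℝ (Fin 3),
        cknAEss r z W ≤ I ∧ cknC r z W ≤ I ∧ cknE r z (fun s y => fderiv ℝ (W s) y) ≤ I) ∧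
      (∀ t x, Tendsto (fun k => v (t + c k) (x + a k)) atTop (𝓝 (W t x))) ∧
      ‖W 0 0‖ = (⨆ q : ℝ × EuclideanSpace ℝ (Fin 3), ‖v q.1 q.2‖) ∧ 0 < ‖W 0 0‖ ∧
      (∀ t x, ‖W t x‖ ≤ ‖W 0 0‖) := by
  -- the supremum `M > 0`
  obtain ⟨M, hM⟩ : ∃ M : ℝ, M = ⨆ q : ℝ × EuclideanSpace ℝ (Fin 3), ‖v q.1 q.2‖ := ⟨_, rfl⟩
  have hbdd : BddAbove (range fun q : ℝ × EuclideanSpace ℝ (Fin 3) => ‖v q.1 q.2‖) :=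
    ⟨N, by rintro _ ⟨q, rfl⟩; exact hbd q.1 q.2⟩
  have hleM : ∀ (t : ℝ) (x : EuclideanSpace ℝ (Fin 3)), ‖v t x‖ ≤ M := fun t x => by
    rw [hM]; exact le_ciSup hbdd (t, x)
  have hMpos : 0 < M := lt_of_lt_of_le (norm_pos_iff.2 h0) (hleM t₀ x₀)
  -- a sup-approximating sequence
  have hseq : ∀ k : ℕ, ∃ q : ℝ × EuclideanSpace ℝ (Fin 3), M - 1 / ((k : ℝ) + 1) < ‖v q.1 q.2‖ := by
    intro k
    have hlt : M - 1 / ((k : ℝ) + 1) < ⨆ q : ℝ × EuclideanSpace ℝ (Fin 3), ‖v q.1 q.2‖ := by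
      rw [← hM]
      have h1 : (0 : ℝ) < 1 / ((k : ℝ) + 1) := by positivity
      linarith
    exact exists_lt_of_lt_ciSup hlt
  choose q hq using hseq
  -- a convergent subsequence of the translates
  obtain ⟨φ, hφ, W, hW, hWdiv, hWmild, hWbd, hWI, hWlim, -⟩ :=
    exists_limit_of_translates hv hdiv hmild hbd hball (fun k => (q k).1) (fun k => (q k).2)
  refine ⟨fun j => (q (φ j)).1, fun j => (q (φ j)).2, W, hW, hWdiv, hWmild, hWbd, hWI, hWlim, ?_⟩
  -- `‖W(0,0)‖ = M`
  have hW00 : ‖W 0 0‖ = M := by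
    have h1 : Tendsto (fun j => ‖v (0 + (q (φ j)).1) (0 + (q (φ j)).2)‖) atTop (𝓝 M) := by
      have hlow : Tendsto (fun j => M - 1 / (((φ j : ℕ) : ℝ) + 1)) atTop (𝓝 M) := by
        have h := tendsto_const_nhds.sub
          (tendsto_one_div_add_atTop_nhds_zero_nat.comp hφ.tendsto_atTop) (a := M)
        simpa using h
      refine tendsto_of_tendsto_of_tendsto_of_le_of_le hlow tendsto_const_nhds (fun j => ?_)
        (fun j => hleM _ _)
      have h := hq (φ j)
      simp only [zero_add]
      exact h.le
    exact tendsto_nhds_unique (hWlim 0 0).norm h1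
  have hWle : ∀ t x, ‖W t x‖ ≤ M := fun t x =>
    le_of_tendsto' (hWlim t x).norm fun j => hleM _ _
  refine ⟨hW00.trans hM, by rw [hW00]; exact hMpos, fun t x => ?_⟩
  rw [hW00]
  exact hWle t x

end Summit.NavierStokesRegularity.NavierStokesRegularity.Theorems.TypeIliouvilleNoTypeII.TypeIIZoom

end
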